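import Mathlib
import HarnessLib
import Summits.NavierStokesRegularity.NavierStokesRegularity.Theorems.FrequencyGrowthExponent.Negative.Reductions
import Summits.NavierStokesRegularity.NavierStokesRegularity.Theorems.FrequencyGrowthExponent.Negative.Strata
import Summits.NavierStokesRegularity.NavierStokesRegularity.Theorems.SymmetryModuliCountLinearLiouvilleSevenFiniteEnergy

/-!
# Crux `FrequencyGrowthExponent` (stmt-NavierStokesRegularity-27893), negative side:
# amplitude and energy thresholds every witness `W` must clear

Negative-side (cdisprove, D-0016) bookkeeping for the wall `LoopPeriodRatchet.FrequencyGrowthExponent`; nothing here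
closes or changes any item (`--supports`).  By `Negative/Reductions.not_frequencyGrowthExponent_iff`, refuting the
wall means CONSTRUCTING `W = HasClassLoop`: an e₃-poloidal Type-I Oseen-mild ancient profile one of whose slices
carries a non-stationary closed vortex line.  This file records, as kernel-checked corollaries of the quantitative
Liouville theorems already in the tree (`exists_typeIAncientMild_eq_zero_of_small_on_end`,
`typeIAncientMild_eq_zero_of_eLpNorm_le`, both resting on the KNSS bilinear bound `‖B(u,u)‖_∞ ≤ C√T‖u‖²_∞` and forward
uniqueness), three thresholds below which the class is `{0}` and hence loop-free:

* `exists_amplitude_threshold` — ONE universal `ε > 0` such that a class profile obeying the small rate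
  `‖v(t,x)‖ ≤ ε/√(−t)` merely on some backward end `t ≤ −R` vanishes identically on the past;
* `exists_threshold_no_small_witness` — in particular Type-I constant `C ≤ ε` forces `v ≡ 0` and no vortex loop:
  `W` does not bifurcate from the zero profile, every witness has `C > ε` and is never small on any backward end
  (for every `R > 0` some `t ≤ −R`, `x` with `‖v(t,x)‖ > ε/√(−t)`);
* `eq_zero_of_eLpNorm_le` / `eLpNorm_unbounded_of_isVortexLoop` — every witness has `sup_{t<0} ‖v(t)‖_{Lᵖ} = ∞` for
  EVERY `1 ≤ p < 3`, in particular unbounded kinetic energy (`energy_unbounded_of_isVortexLoop`): no finite-energy or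
  uniformly-`Lᵖ`-subcritical ansatz can produce `W` (`hasClassLoop_iff_large`).

The e₃-poloidal hypothesis of the class is not used by any of these (they hold for the full Type-I Oseen-mild class),
which is recorded by omitting it from the binders.

HONEST FRAMING: corollaries of landed theorems, recorded for the W-census of the negation-first reading (req192);
nothing here bears on `PoloidalWindowDoor.Target` or on Navier–Stokes regularity; item 27893 stays OPEN.
-/

noncomputable section

-- the summit and its single sub-problem share the name (CONVENTIONS §1), as in every Theorems file
set_option linter.dupNamespace false

namespace Summit.NavierStokesRegularity.NavierStokesRegularity.Theorems.FrequencyGrowthExponent.Negative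

open Set Function Filter Topology MeasureTheory
open scoped RealInnerProductSpace InnerProductSpace ENNReal
open Literature.Analysis Literature.Analysis.FluidPDE Literature.Analysis.UnboundedOperators
open Summit.NavierStokesRegularity.NavierStokesRegularity.Theorems
open Summit.NavierStokesRegularity.NavierStokesRegularity.Theorems.PoloidalWindowDoorPoloidalWindowRigidityWindow

variable {C : ℝ} {v : ℝ → EuclideanSpace ℝ (Fin 3) → EuclideanSpace ℝ (Fin 3)}

/-! ### The universal amplitude threshold -/

/-- **Amplitude threshold (the far past decides).** There is a universal `ε > 0` such that every profile of the
class (Type-I time rate with ANY constant `C`, continuity on the open past slab, unit-viscosity Oseen–Duhamel identity,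
divergence-free slices) which obeys the SMALL rate `‖v(t,x)‖ ≤ ε/√(−t)` on some backward end `t ≤ −R` (`R > 0`)
vanishes identically on `t < 0`.  (`isTypeIAncientMild_of_class` + `exists_typeIAncientMild_eq_zero_of_small_on_end`.)
[cite: KochNadirashviliSereginSverak2009, §4 p. 8 (arXiv:0709.3599); Leray1934, (3.9)] -/
theorem exists_amplitude_threshold :
    ∃ ε : ℝ, 0 < ε ∧ ∀ (C : ℝ) (v : ℝ → EuclideanSpace ℝ (Fin 3) → EuclideanSpace ℝ (Fin 3)),
      HasTypeITimeDecay C v → ContinuousOn (uncurry v) (Iio (0 : ℝ) ×ˢ univ) →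
      (∀ s t : ℝ, s < t → t < 0 → ∀ x, v t x = heatExtension (v s) (t - s) x - oseenDuhamel 1 s v v t x) →
      (∀ t < 0, VectorCalculus.IsDivFree (v t)) →
      ∀ R : ℝ, 0 < R → (∀ t, t ≤ -R → ∀ x, ‖v t x‖ ≤ ε / Real.sqrt (-t)) → ∀ t < 0, ∀ x, v t x = 0 := by
  obtain ⟨ε, hε, hend⟩ := exists_typeIAncientMild_eq_zero_of_small_on_end
  exact ⟨ε, hε, fun C v hrate hcont hmild hdiv R hR hsmall =>
    hend C v (isTypeIAncientMild_of_class hrate hcont hmild hdiv) R hR hsmall⟩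

/-! ### No small witness: a small Type-I constant forces the zero profile -/

/-- **No small witness.** With the universal `ε > 0` of `exists_amplitude_threshold`: (i) a class profile with Type-I
constant `C ≤ ε` vanishes identically on the past (its rate is the small rate on every backward end), so it carries no
non-stationary closed vortex line on any slice; (ii) consequently, if a class profile carries a vortex loop
(`IsVortexLoop`) on some slice `t < 0`, then its Type-I constant exceeds `ε` — `W` does not bifurcate from the zero
profile — and it is never small in the far past: on every backward end `t' ≤ −R` (`R > 0`) there are `t', x` with
`‖v(t',x)‖ > ε/√(−t')`, i.e. `sup_{t' ≤ −R} √(−t')‖v(t')‖_∞ ≥ ε` for all `R` (Leray's lower bound in ancient form).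
[cite: KochNadirashviliSereginSverak2009, §4 p. 8 (arXiv:0709.3599); Leray1934, (3.9)] -/
theorem exists_threshold_no_small_witness :
    ∃ ε : ℝ, 0 < ε ∧ ∀ (C : ℝ) (v : ℝ → EuclideanSpace ℝ (Fin 3) → EuclideanSpace ℝ (Fin 3)),
      HasTypeITimeDecay C v → ContinuousOn (uncurry v) (Iio (0 : ℝ) ×ˢ univ) →
      (∀ s t : ℝ, s < t → t < 0 → ∀ x, v t x = heatExtension (v s) (t - s) x - oseenDuhamel 1 s v v t x) →
      (∀ t < 0, VectorCalculus.IsDivFree (v t)) →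
      (C ≤ ε → ∀ t < 0, ∀ x, v t x = 0) ∧
      (C ≤ ε → ∀ t < 0, ∀ (c : ℝ → EuclideanSpace ℝ (Fin 3)) (T : ℝ), ¬ IsVortexLoop v t c T) ∧
      (∀ t < 0, ∀ (c : ℝ → EuclideanSpace ℝ (Fin 3)) (T : ℝ), IsVortexLoop v t c T →
        ε < C ∧ ∀ R : ℝ, 0 < R → ∃ t' ≤ -R, ∃ x, ε / Real.sqrt (-t') < ‖v t' x‖) := by
  obtain ⟨ε, hε, hend⟩ := exists_amplitude_threshold
  refine ⟨ε, hε, fun C v hrate hcont hmild hdiv => ?_⟩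
  -- (i) small constant ⇒ small rate on the backward end `t ≤ -1` ⇒ zero
  have hzero : C ≤ ε → ∀ t < 0, ∀ x, v t x = 0 := fun hC =>
    hend C v hrate hcont hmild hdiv 1 one_pos fun t ht x =>
      (hrate t (by linarith) x).trans (div_le_div_of_nonneg_right hC (Real.sqrt_nonneg _))
  have hnoloop : C ≤ ε → ∀ t < 0, ∀ (c : ℝ → EuclideanSpace ℝ (Fin 3)) (T : ℝ), ¬ IsVortexLoop v t c T :=
    fun hC t ht c T h =>
      no_nonstationary_vortexLine_of_curl_eq_zero (curl_eq_zero_of_eq_zero (hzero hC)) ht c h.2.2.2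
  refine ⟨hzero, hnoloop, fun t ht c T hloop => ⟨lt_of_not_ge fun hC => hnoloop hC t ht c T hloop, ?_⟩⟩
  -- (ii) far past: smallness on the end `t' ≤ -R` would force `v ≡ 0`, contradicting the loop
  intro R hR
  by_contra h
  push Not at h
  exact no_nonstationary_vortexLine_of_curl_eq_zero
    (curl_eq_zero_of_eq_zero (hend C v hrate hcont hmild hdiv R hR h)) ht c hloop.2.2.2

/-! ### No finite-energy witness: every subcritical `Lᵖ` norm of a witness is unbounded in time -/

/-- **Uniformly `Lᵖ`-bounded class profiles are trivial (`1 ≤ p < 3`).** A class profile with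
`sup_{t<0} ‖v(t)‖_{Lᵖ} ≤ N < ∞` for some `1 ≤ p < 3` vanishes identically (heat `Lᵖ → L^∞` smoothing makes the rate
small on a backward end). [cite: KochNadirashviliSereginSverak2009, §4 p. 8; GigaGigaSaal2010, §1.1.2–1.1.3] -/
theorem eq_zero_of_eLpNorm_le {p : ℝ≥0∞} (hp1 : 1 ≤ p) (hp3 : p < 3) {N : ℝ} (hrate : HasTypeITimeDecay C v)
    (hcont : ContinuousOn (uncurry v) (Iio (0 : ℝ) ×ˢ univ))
    (hmild : ∀ s t : ℝ, s < t → t < 0 → ∀ x, v t x = heatExtension (v s) (t - s) x - oseenDuhamel 1 s v v t x)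
    (hdiv : ∀ t < 0, VectorCalculus.IsDivFree (v t)) (hN : ∀ t < 0, eLpNorm (v t) p volume ≤ ENNReal.ofReal N) :
    ∀ t < 0, ∀ x, v t x = 0 :=
  typeIAncientMild_eq_zero_of_eLpNorm_le hp1 hp3 (isTypeIAncientMild_of_class hrate hcont hmild hdiv) hN

/-- **Every witness has unbounded subcritical norms.** If a class profile carries a vortex loop on some slice, then
for every `1 ≤ p < 3` and every `N`, some slice `t < 0` has `‖v(t)‖_{Lᵖ} > N` (the value `∞` included):
`sup_{t<0} ‖v(t)‖_{Lᵖ} = ∞`. -/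
theorem eLpNorm_unbounded_of_isVortexLoop (hrate : HasTypeITimeDecay C v)
    (hcont : ContinuousOn (uncurry v) (Iio (0 : ℝ) ×ˢ univ))
    (hmild : ∀ s t : ℝ, s < t → t < 0 → ∀ x, v t x = heatExtension (v s) (t - s) x - oseenDuhamel 1 s v v t x)
    (hdiv : ∀ t < 0, VectorCalculus.IsDivFree (v t)) {t : ℝ} (ht : t < 0) {c : ℝ → EuclideanSpace ℝ (Fin 3)} {T : ℝ}
    (hloop : IsVortexLoop v t c T) {p : ℝ≥0∞} (hp1 : 1 ≤ p) (hp3 : p < 3) (N : ℝ) :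
    ∃ t' < 0, ENNReal.ofReal N < eLpNorm (v t') p volume := by
  by_contra h
  push Not at h
  exact no_nonstationary_vortexLine_of_curl_eq_zero
    (curl_eq_zero_of_eq_zero (eq_zero_of_eLpNorm_le hp1 hp3 hrate hcont hmild hdiv h)) ht c hloop.2.2.2

/-- **Every witness has unbounded kinetic energy**: `sup_{t<0} ‖v(t)‖_{L²} = ∞` (the case `p = 2`). -/
theorem energy_unbounded_of_isVortexLoop (hrate : HasTypeITimeDecay C v)
    (hcont : ContinuousOn (uncurry v) (Iio (0 : ℝ) ×ˢ univ))
    (hmild : ∀ s t : ℝ, s < t → t < 0 → ∀ x, v t x = heatExtension (v s) (t - s) x - oseenDuhamel 1 s v v t x)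
    (hdiv : ∀ t < 0, VectorCalculus.IsDivFree (v t)) {t : ℝ} (ht : t < 0) {c : ℝ → EuclideanSpace ℝ (Fin 3)} {T : ℝ}
    (hloop : IsVortexLoop v t c T) (N : ℝ) : ∃ t' < 0, ENNReal.ofReal N < eLpNorm (v t') 2 volume :=
  eLpNorm_unbounded_of_isVortexLoop hrate hcont hmild hdiv ht hloop (p := 2) (by norm_num) (by norm_num) N

/-! ### The thresholds in `W`-form -/

/-- **`W` with its forced size constraint.** `HasClassLoop` is equivalent to its apparently stronger form in which
the witness profile is also required to have `sup_{t<0} ‖v(t)‖_{Lᵖ} = ∞` for every `1 ≤ p < 3` (unbounded kinetic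
energy included): any construction of `W` may assume, and must deliver, infinite subcritical norms. -/
theorem hasClassLoop_iff_large : HasClassLoop ↔
    ∃ (C : ℝ) (v : ℝ → EuclideanSpace ℝ (Fin 3) → EuclideanSpace ℝ (Fin 3)),
      HasTypeITimeDecay C v ∧ ContinuousOn (uncurry v) (Iio (0 : ℝ) ×ˢ univ) ∧
      (∀ s t : ℝ, s < t → t < 0 → ∀ x, v t x = heatExtension (v s) (t - s) x - oseenDuhamel 1 s v v t x) ∧
      (∀ t < 0, VectorCalculus.IsDivFree (v t)) ∧
      (∀ s < 0, ∀ y, ⟪curl (v s) y, EuclideanSpace.single 2 1⟫_ℝ = 0) ∧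
      (∃ t : ℝ, t < 0 ∧ ∃ (c : ℝ → EuclideanSpace ℝ (Fin 3)) (T : ℝ), IsVortexLoop v t c T) ∧
      (∀ (p : ℝ≥0∞), 1 ≤ p → p < 3 → ∀ N : ℝ, ∃ t' < 0, ENNReal.ofReal N < eLpNorm (v t') p volume) := by
  constructor
  · rintro ⟨C, v, hrate, hcont, hmild, hdiv, hpol, t, ht, c, T, hloop⟩
    exact ⟨C, v, hrate, hcont, hmild, hdiv, hpol, ⟨t, ht, c, T, hloop⟩,
      fun p hp1 hp3 N => eLpNorm_unbounded_of_isVortexLoop hrate hcont hmild hdiv ht hloop hp1 hp3 N⟩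
  · rintro ⟨C, v, hrate, hcont, hmild, hdiv, hpol, hW, -⟩
    exact ⟨C, v, hrate, hcont, hmild, hdiv, hpol, hW⟩

end Summit.NavierStokesRegularity.NavierStokesRegularity.Theorems.FrequencyGrowthExponent.Negative

end
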